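import Summits.RiemannHypothesis.RiemannHypothesis.Theorems.ThetaTier2RowSound
import HarnessLib

/-!
# THETA tier-2 kernel rows — twin primes `4931 ≤ q ≤ 5741` (module 8 of 13; cc-s2-1, WEIL typing lane; RH-FREE bookkeeping)

Data module of the tier-2 theta certificate (THETA-CERT-cc6 §E; HOME/cc-s2-1/gen22/TIER2-KERNEL-SPEC.md; soundness chain
`ThetaTier2Check … ThetaTier2RowSound`): the rows `(q, q⁺, m, δ·10¹², menu, k)` — `m = 5`, `δ = ⌊0.98·δ_q·10¹²⌋/10¹²` with
`δ_q = ½ log(q⁺/q)`, menu `0` = thin seed `(1/20, 19/20, 1)`, `η′ = 1/100` (menu `1` = `(1/4, 3/5, 1)`, `η′ = 1/20` for `q = 179, 191`),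
`t₀ = 2⁻¹⁵`; `K = 6`, `τ = 1/100`, `D = 3`, `W_l = 4`, `J = 64` — for the twin primes `4931 ≤ q ≤ 5741` in the range of the route item
`stmt-RiemannHypothesis-19172` (`WallsTenKTwin`, `route-RiemannHypothesis-WeilSemilocal`), checked in the kernel by `Row2.check`
(`decide +kernel`, ≈ 14 s per row), and the resulting REAL statements `T2Valid r.inp r.real ∧ r.RowFacts` (`Row2.check_sound`) that the
E-side assembly turns into `UC(q)`.  Nothing here bears on the truth of RH.
-/

set_option linter.dupNamespace false  -- the mandated namespace repeats `RiemannHypothesis`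

namespace Summit.RiemannHypothesis.RiemannHypothesis.Theorems.ThetaTier2

/-- Twin rows `4931 ≤ q ≤ 5417` (8 rows). [this cell, TIER2-KERNEL-SPEC §4] -/
def twinRows08_1 : List Row2 := [
  ⟨4931, 4933, 5, 198702354, 0, 15⟩, ⟨4967, 4969, 5, 197262482, 0, 15⟩, ⟨5009, 5011, 5, 195608785, 0, 15⟩, ⟨5021, 5023, 5, 195141380, 0, 15⟩,
  ⟨5099, 5101, 5, 192156865, 0, 15⟩, ⟨5231, 5233, 5, 187308870, 0, 15⟩, ⟨5279, 5281, 5, 185606062, 0, 15⟩, ⟨5417, 5419, 5, 180878555, 0, 15⟩ ]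

/-- The kernel verdict for `twinRows08_1`. [this cell, THETA-CERT-cc6 §E6] -/
theorem twinRows08_1_check : twinRows08_1.all Row2.check = true := by
  decide +kernel

/-- (K1)–(K7) and the row facts at every row of `twinRows08_1`. [this cell, THETA-CERT-cc6 §E6] -/
theorem twinRows08_1_valid : ∀ r ∈ twinRows08_1, T2Valid r.inp r.real ∧ r.RowFacts :=
  fun r hr => r.check_sound (List.all_eq_true.1 twinRows08_1_check r hr)

/-- Twin rows `5441 ≤ q ≤ 5741` (8 rows). [this cell, TIER2-KERNEL-SPEC §4] -/
def twinRows08_2 : List Row2 := [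
  ⟨5441, 5443, 5, 180080854, 0, 15⟩, ⟨5477, 5479, 5, 178897409, 0, 15⟩, ⟨5501, 5503, 5, 178117050, 0, 15⟩, ⟨5519, 5521, 5, 177536233, 0, 15⟩,
  ⟨5639, 5641, 5, 173758867, 0, 15⟩, ⟨5651, 5653, 5, 173389952, 0, 15⟩, ⟨5657, 5659, 5, 173206081, 0, 15⟩, ⟨5741, 5743, 5, 170672241, 0, 15⟩ ]

/-- The kernel verdict for `twinRows08_2`. [this cell, THETA-CERT-cc6 §E6] -/
theorem twinRows08_2_check : twinRows08_2.all Row2.check = true := by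
  decide +kernel

/-- (K1)–(K7) and the row facts at every row of `twinRows08_2`. [this cell, THETA-CERT-cc6 §E6] -/
theorem twinRows08_2_valid : ∀ r ∈ twinRows08_2, T2Valid r.inp r.real ∧ r.RowFacts :=
  fun r hr => r.check_sound (List.all_eq_true.1 twinRows08_2_check r hr)

end Summit.RiemannHypothesis.RiemannHypothesis.Theorems.ThetaTier2
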